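import Summits.Langlands.Langlands.Theses.OrdinaryPrimeTransport
import Literature.NumberTheory.GaloisRepresentations.AlgebraicMonodromyLie
import Literature.NumberTheory.GaloisRepresentations.InducedGaloisRep
import Literature.NumberTheory.GaloisRepresentations.FramedRepBlockSum
import Literature.NumberTheory.GaloisRepresentations.WeakAbelianDirectSummand

/-!
# Line `clifford-gabber-hui` — crux `PrimeRankTransport` (stmt-Langlands-17213), route OrdinaryPrimeTransport

Strategist ALT line (the registered line `birth` exists).  The crux
`Summit.Langlands.Langlands.Theses.OrdinaryPrimeTransport.PrimeRankTransport` — "on the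
prime-rank non-self-dual sector, irreducible at ONE `(ℓ₀, ι₀)` ⇒ irreducible at EVERY `(ℓ, ι)`" — is
assembled HODGE-FREE from seven stubs along the chain

  HLTT existence (S1) ⟶ CLIFFORD trichotomy in prime dimension (S2) ⟶
  shapes Artin⊗character / induced PROPAGATE by Böckle–Hui weak abelian divisibility (S3, a tree
  THEOREM) ⟶ Lie-irreducible & not a twist of its dual ⇒ semisimple rank `p − 1` by GABBER's
  prime-dimension theorem (S4) ⟵ twist-self-dual ⇒ essentially self-dual at Satake level (S5) ⟶
  HUI's `λ`-independence of the semisimple rank (S6, formal bi-character; printed for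
  `ℚ̄_ℓ`-valued weakly compatible families, Hui 2023 Thm 2.7) ⟶ full semisimple rank forces
  irreducibility of every compatible avatar (S7, rank count).

What is new relative to `Lines/birth.lean` (3 stubs; hardest `stub_lieIrreducibleTransport` bundles
AHTW Hodge–Tate regularity + Howe's multiplicity-free list + Hui): (i) NO `p`-adic Hodge theory
anywhere — Gabber (Katz, ESDE Thm 1.6) needs only prime dimension, the finite-projective-image
shape is PROPAGATED (Tate lift + Böckle–Hui 1.1) instead of being excluded by HT-regularity, and
the similitude character is made Hecke by weak divisibility, not by de Rham ⇒ the totally real case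
needs no CM base change; (ii) the Hui input is ONE stub (S6) whose statement mentions neither
self-duality nor Hodge theory and uses the LANDED `semisimpleRankOf`
(`Literature/NumberTheory/GaloisRepresentations/AlgebraicMonodromyLie.lean`); (iii) the vocabulary
(`IsLieIrreducible`, `HasFiniteProjectiveImage`, `IsInducedFromDegree`, `IsTwistSelfDual`) is VERBATIM
that of the sibling region skeleton
`Cruxes/IrreducibleOffSector/RegionSkeleton_prime_rank_transport.lean` (route
IrreducibilityBySelfDuality, polarized sector), so the cite items wi-38101 (Gabber), wi-38102 (Hui),
wi-38103 (Tate) serve both cruxes; (iv) TRANSFER with teeth: the sibling's obstruction to the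
non-polarized case ("unprinted CoefficientDescentHLTT", E_λ-models) is not needed — Hui, JLMS 2023 =
arXiv:2208.04002, Thm 2.7 states bi-character independence for SCS **or WCS**, i.e. for
`ℚ̄_ℓ`-valued E-rational families (typed below as `HuiCompatibleSemisimpleRank`, the target shape we
ask wi-38102 to take), and the good prime, which the sibling region had to import from
Patrikis–Taylor, is here the crux's HYPOTHESIS.

`PrimeRankTransport_of : PrimeRankTransport` concludes the crux BY NAME through the sorry-free
`PrimeRankTransport_of_stubs`; `sorry` occurs only in the seven `stub_*`.
-/

noncomputable section

set_option linter.dupNamespace false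
set_option linter.unusedVariables false

open scoped NumberField Classical Matrix Polynomial
open Filter IsDedekindDomain NumberField Polynomial
open Literature.NumberTheory.Automorphic Literature.NumberTheory.GaloisRepresentations
open Summit.Langlands
open Summit.Langlands.Langlands.Theses.OrdinaryPrimeTransport

namespace Summit.Langlands.Langlands.Cruxes.PrimeRankTransport.CliffordGabberHui

/-! ## §0 Vocabulary (verbatim the sibling region skeleton's, plus two abbreviations of the
crux's own clauses) -/

variable {K : Type} [Field K] [NumberField K] {ℓ : ℕ} [Fact ℓ.Prime] {n : ℕ}

/-- `ρ` is Satake–Frobenius compatible with `(π, ι)` at all but finitely many places — VERBATIM the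
compatibility clause of the crux (L-normalisation, `arithFrobPolyOfSatake ι q_v 1 α`). -/
def IsCompatibleAE {p : ℕ} {hcpt : isCompact_glFiniteIntegralLevel p K}
    (ι : PadicAlgCl ℓ ≃+* ℂ) (π : CuspidalAutomorphicRepData p K hcpt)
    (ρ : FramedGaloisRep K (PadicAlgCl ℓ) p) : Prop :=
  ∀ᶠ v : HeightOneSpectrum (𝓞 K) in cofinite, SatakeFrobCompatibleAt ι π.1 ρ v

/-- `π` is essentially self-dual AT SATAKE LEVEL — VERBATIM the clause the crux negates: some
cuspidal `GL(1)` datum `η` with `{α_j⁻¹} = {η(ϖ_v) α_j}` a.e. -/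
def IsEssSelfDualSatake {p : ℕ} {hcpt : isCompact_glFiniteIntegralLevel p K}
    (π : CuspidalAutomorphicRepData p K hcpt) : Prop :=
  ∃ (h1 : isCompact_glFiniteIntegralLevel 1 K) (η : CuspidalAutomorphicRepData 1 K h1),
    ∀ᶠ v : HeightOneSpectrum (𝓞 K) in cofinite, ∀ α : Multiset ℂ, π.1.HasSatakeParamAt v α →
      ∃ e : ℂ, η.1.HasSatakeParamAt v {e} ∧ α.map (fun a => a⁻¹) = α.map (fun a => e * a)

/-- The scalar value of a rank-one framed representation. -/
def scalar11 {G : Type*} [Group G] [TopologicalSpace G] {A : Type*} [CommRing A]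
    [TopologicalSpace A] (c : FramedRep G A 1) (g : G) : A :=
  ((c g : GL (Fin 1) A) : Matrix (Fin 1) (Fin 1) A) 0 0

/-- **Lie-irreducible**: irreducible, and irreducible after restriction to every finite extension
`F/K` (= on every open subgroup of `Γ_K`). Verbatim the sibling's. -/
def IsLieIrreducible (r : FramedGaloisRep K (PadicAlgCl ℓ) n) : Prop :=
  r.toGaloisRep.IsIrreducible ∧
    ∀ (F : Type) [Field F] [NumberField F] [Algebra K F], (r.restrictField F).toGaloisRep.IsIrreducible

/-- Clifford shape (i): FINITE PROJECTIVE IMAGE — some open subgroup `Γ_F` acts by scalars.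
Verbatim the sibling's. -/
def HasFiniteProjectiveImage (r : FramedGaloisRep K (PadicAlgCl ℓ) n) : Prop :=
  ∃ (F : Type) (_ : Field F) (_ : NumberField F) (_ : Algebra K F),
    ∀ σ : Field.absoluteGaloisGroup F, ∃ c : PadicAlgCl ℓ,
      ((r.restrictField F σ : GL (Fin n) (PadicAlgCl ℓ)) : Matrix (Fin n) (Fin n) (PadicAlgCl ℓ)) =
        c • (1 : Matrix (Fin n) (Fin n) (PadicAlgCl ℓ))

/-- Clifford shape (ii): INDUCED from a character of a degree-`p` extension `F/K` (tree
`FramedGaloisRep.induce`, relabelled `Fin (p * 1) ≃ Fin p`, up to a frame). Verbatim the sibling's. -/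
def IsInducedFromDegree (p : ℕ) (r : FramedGaloisRep K (PadicAlgCl ℓ) p) : Prop :=
  ∃ (F : Type) (_ : Field F) (_ : NumberField F) (_ : Algebra K F) (_ : FiniteDimensional K F)
    (hF : Module.finrank K F = p) (χ : FramedGaloisRep F (PadicAlgCl ℓ) 1) (e : Fin (p * 1) ≃ Fin p)
    (P : GL (Fin p) (PadicAlgCl ℓ)), r = FramedRep.conj P (FramedRep.reindex e (χ.induce K hF))

/-- `r ≅ r^∨ ⊗ c` for a continuous character `c` (a conjugate of `r` is the `c`-twist of the
transpose-inverse). Verbatim the sibling's. -/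
def IsTwistSelfDual (r : FramedGaloisRep K (PadicAlgCl ℓ) n) : Prop :=
  ∃ (c : FramedGaloisRep K (PadicAlgCl ℓ) 1) (P : GL (Fin n) (PadicAlgCl ℓ)),
    ∀ g : Field.absoluteGaloisGroup K,
      ((FramedRep.conj P r g : GL (Fin n) (PadicAlgCl ℓ)) : Matrix (Fin n) (Fin n) (PadicAlgCl ℓ)) =
        scalar11 c g •
          ((FramedRep.dual r g : GL (Fin n) (PadicAlgCl ℓ)) : Matrix (Fin n) (Fin n) (PadicAlgCl ℓ))

/-- The semisimple rank of (the Zariski closure of) the image of `r`, through the LANDED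
`Literature.NumberTheory.GaloisRepresentations.semisimpleRankOf` (`rank 𝔤 − dim 𝔷(𝔤)`,
`𝔤 = Lie(Zar r(Γ_K)) ⊆ 𝔤𝔩_n(ℚ̄_ℓ)`; Hui 2013 (3.20)). -/
def ssRank (r : FramedGaloisRep K (PadicAlgCl ℓ) n) : ℕ :=
  semisimpleRankOf (PadicAlgCl ℓ) (Fin n) r.toMonoidHom.range

/-- The embedding `E ↪ ℂ ≃ ℚ̄_ℓ` of a subfield `E ⊂ ℂ` determined by `ι`. Verbatim the sibling's. -/
def subfieldEmb (E : Subfield ℂ) (ι : PadicAlgCl ℓ ≃+* ℂ) : E →+* PadicAlgCl ℓ :=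
  (ι.symm : ℂ ≃+* PadicAlgCl ℓ).toRingHom.comp E.subtype

/-! ## §F The printed transport input, typed in the form this line consumes (documentation: the
target shape asked of cite item wi-38102; NOT a hypothesis of any stub) -/

/-- **Hui's `λ`-independence of the semisimple rank, compatible-family form** (Hui, MRL 20 (2013) =
arXiv:1204.5271, Thm 3.19 p. 13 + Rem 3.22 p. 15; restated for `Ē_λ`-valued families in Hui,
JLMS (2023) = arXiv:2208.04002, Thm 2.7 p. 9: "Let `{ρ_λ}` be a SCS **or WCS**. The formal
bi-character of `G_λ ⊂ GL_n` is independent of `λ`" — hence so is the semisimple rank): for a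
family of SEMISIMPLE representations `r ℓ ι : Γ_K → GL_n(ℚ̄_ℓ)` indexed by `(ℓ, ι)` which is
`E`-rational and compatible in Serre's sense — off ONE finite set of places every member with
`v ∤ ℓ` is unramified at `v` with Frobenius polynomial `Q_v ∈ E[X]` (the same `Q_v` for all
members) — all the `ssRank (r ℓ ι)` agree.  Versus the sibling's `Hui2013SemisimpleRank`: no
`E_λ`-MODEL clause (entries in the closure of `ι⁻¹ E`); that clause is dispensable because
(a) Hui 2023 states Thm 2.7 for weakly compatible systems, which are `Ē_λ`-valued by definition
(§2.4.3), and (b) in the proof [Hu13 §3] the abelianised representation only needs ALGEBRAIC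
Frobenius eigenvalues (Rem 3.15) and Serre's `S_𝔪`-theory over any finite extension of `ℚ_ℓ`
(Rem 3.22), each member being realisable over some finite `L/ℚ_ℓ` by compactness.  The
Hodge-theoretic clauses (wcs)(ii)–(iii) of a WCS play no role in Thm 2.4/2.7 (Frobenius tori +
abelian `ℓ`-adic theory); a vendor who wants them verbatim adds de Rham / `τ`-HT clauses, which
AHTW 2026 Thm 1.2.1 supplies on the CM sector. -/
def HuiCompatibleSemisimpleRank : Prop :=
  ∀ (K : Type) [Field K] [NumberField K] (n : ℕ) (E : Subfield ℂ), FiniteDimensional ℚ E →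
    ∀ r : ∀ (ℓ : ℕ) [Fact ℓ.Prime], (PadicAlgCl ℓ ≃+* ℂ) → FramedGaloisRep K (PadicAlgCl ℓ) n,
      (∀ (ℓ : ℕ) [Fact ℓ.Prime] (ι : PadicAlgCl ℓ ≃+* ℂ), (r ℓ ι).toGaloisRep.IsSemisimple) →
      (∀ᶠ v : HeightOneSpectrum (𝓞 K) in cofinite, ∃ Q : Polynomial E,
          ∀ (ℓ : ℕ) [Fact ℓ.Prime] (ι : PadicAlgCl ℓ ≃+* ℂ), ((ℓ : ℕ) : 𝓞 K) ∉ v.asIdeal →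
            (r ℓ ι).IsUnramifiedAt v ∧ (r ℓ ι).HasFrobCharpolyAt v (Q.map (subfieldEmb E ι))) →
      ∀ (ℓ₁ : ℕ) [Fact ℓ₁.Prime] (ι₁ : PadicAlgCl ℓ₁ ≃+* ℂ) (ℓ₂ : ℕ) [Fact ℓ₂.Prime]
        (ι₂ : PadicAlgCl ℓ₂ ≃+* ℂ), ssRank (r ℓ₁ ι₁) = ssRank (r ℓ₂ ι₂)

/-! ## §S The seven stub STATEMENTS (named `…Stmt`, the antecedents of the assembly) and the
seven REGISTERED STUBS `stub_*` (the same statements inlined, so that the registrar records them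
verbatim; `stub_x : XStmt` definitionally) -/

/-- **S1 · a compatible avatar exists at every `(ℓ, ι)`** (Harris–Lan–Taylor–Thorne 2016 Thm A /
Scholze; tree named fact `HarrisLanTaylorThorne2016.theoremA_existence`, C-normalised `m = n`,
twisted by `ε_ℓ^{(p−1)/2}` — integral since `p` is odd, which is also why L-algebraic =
C-algebraic here).  VERBATIM `Birth.stub_avatarExists` (shared obligation): the crux's `∃∀`
hypothesis is silent about existence at the good prime (refuter OPT-review), so any proof needs it. -/
def AvatarExistsStmt : Prop :=
  ∀ (K : Type) [Field K] [NumberField K], (IsTotallyReal K ∨ IsCMField K) → ∀ (p : ℕ), Nat.Prime p →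
    3 ≤ p → ∀ (hcpt : isCompact_glFiniteIntegralLevel p K) (π : CuspidalAutomorphicRepData p K hcpt),
    π.1.IsLAlgebraic → (∃ T : InfinityType K p, π.1.HasInfinityType T ∧ T.IsRegular) →
    ∀ (ℓ : ℕ) [Fact ℓ.Prime] (ι : PadicAlgCl ℓ ≃+* ℂ),
      ∃ ρ : FramedGaloisRep K (PadicAlgCl ℓ) p, IsCompatibleAE ι π ρ

/-- **S2 · Clifford trichotomy in prime dimension** (profinite Clifford theory on the normal core of
a small open subgroup; isotypic count `e · t · dim W = p`): an IRREDUCIBLE `r : Γ_K → GL_p(ℚ̄_ℓ)`,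
`p` prime, has finite projective image, or is induced from a character of a degree-`p` extension,
or is Lie-irreducible.  No Zariski closure, no Hodge theory.  VERBATIM the sibling's K4a. -/
def CliffordTrichotomyStmt : Prop :=
  ∀ (K : Type) [Field K] [NumberField K] (ℓ : ℕ) [Fact ℓ.Prime] (p : ℕ), Nat.Prime p →
    ∀ r : FramedGaloisRep K (PadicAlgCl ℓ) p, r.toGaloisRep.IsIrreducible →
      HasFiniteProjectiveImage r ∨ IsInducedFromDegree p r ∨ IsLieIrreducible r

/-- **S3 · shapes (i)/(ii) propagate to every `(ℓ, ι)`** (Tate's finite-projective lift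
`r₀ = σ ⊗ ψ`, cite wi-38103; `E`-rationality of the L-normalised Satake polynomials from Clozel's
Hecke field `Clozel1990_heckeEigenvalueField`, `(p−1)/2 ∈ ℤ`; the character `ψ`, resp. `χ` on
`Γ_F`, weakly divides an `E`-rational semisimple representation, so it is an algebraic Hecke
character by Böckle–Hui 1.1 = the tree THEOREM `exists_heckeCharacter_of_weaklyDivides_holds`;
Weil avatars `HeckeCharacter.IsAlgebraic.exists_lAdic` at `(ℓ, ι)`; Chebotarev–Brauer–Nesbitt
`FramedGaloisRep.nonempty_equiv_of_hasFrobCharpolyAt_eventually`; Mackey's criterion for the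
induced shape is an identity of algebraic Hecke characters of `F · gF`, hence `λ`-free): on the
sector, if a compatible IRREDUCIBLE `ρ₀` at `(ℓ₀, ι₀)` has shape (i) or (ii), every compatible `ρ`
at every `(ℓ, ι)` is irreducible. -/
def PropagateArtinOrInducedStmt : Prop :=
  ∀ (K : Type) [Field K] [NumberField K], (IsTotallyReal K ∨ IsCMField K) → ∀ (p : ℕ), Nat.Prime p →
    3 ≤ p → ∀ (hcpt : isCompact_glFiniteIntegralLevel p K) (π : CuspidalAutomorphicRepData p K hcpt),
    π.1.IsLAlgebraic → (∃ T : InfinityType K p, π.1.HasInfinityType T ∧ T.IsRegular) →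
    ∀ (ℓ₀ : ℕ) [Fact ℓ₀.Prime] (ι₀ : PadicAlgCl ℓ₀ ≃+* ℂ) (ρ₀ : FramedGaloisRep K (PadicAlgCl ℓ₀) p),
      IsCompatibleAE ι₀ π ρ₀ → ρ₀.toGaloisRep.IsIrreducible →
      (HasFiniteProjectiveImage ρ₀ ∨ IsInducedFromDegree p ρ₀) →
    ∀ (ℓ : ℕ) [Fact ℓ.Prime] (ι : PadicAlgCl ℓ ≃+* ℂ) (ρ : FramedGaloisRep K (PadicAlgCl ℓ) p),
      IsCompatibleAE ι π ρ → ρ.toGaloisRep.IsIrreducible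

/-- **S4 · Gabber: Lie-irreducible and not a twist of the dual forces semisimple rank `p − 1`**
(Katz, *Exponential sums and differential equations*, AM-124, Thm 1.6 p. 11 (Gabber), cite wi-38101:
a semisimple irreducible `𝔰 ⊂ End V` with `dim V = p` prime is `𝔰𝔩(V)` or preserves a non-degenerate
symmetric form — `𝔰𝔩₂` in `Sym^{p−1}`, `𝔰𝔬_p`, `𝔤₂ ⊂ 𝔰𝔬₇`; dictionary: `𝔤 = Lie(Zar r(Γ_K))` acts
irreducibly iff `r` is Lie-irreducible, `𝔷(𝔤)` is scalar, `𝔰 = [𝔤, 𝔤]`; in the orthogonal case the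
image normalises `𝔰`, the `𝔰`-invariant form `B` is unique up to scalar, so `ᵗr(g) J r(g) = μ(g) J`,
i.e. `IsTwistSelfDual r` with `P = J`, `c = μ ∘ r`; else `𝔰 = 𝔰𝔩_p` of rank `p − 1`).  NO
regularity / Hodge–Tate input.  The sibling's K1a with the landed `semisimpleRankOf`. -/
def FullRankOfNotTwistSelfDualStmt : Prop :=
  ∀ (K : Type) [Field K] [NumberField K] (ℓ : ℕ) [Fact ℓ.Prime] (p : ℕ), Nat.Prime p →
    ∀ r : FramedGaloisRep K (PadicAlgCl ℓ) p, IsLieIrreducible r → ¬ IsTwistSelfDual r →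
      ssRank r + 1 = p

/-- **S5 · a twist-self-dual compatible avatar makes `π` essentially self-dual at Satake level**
(`ρ ≅ ρ^∨ ⊗ c` ⇒ `c ↪ ρ ⊗ ρ`, so `c` weakly divides the semisimplification of `ρ ⊗ ρ`, `E`-rational by
Clozel ⇒ Böckle–Hui 1.1 (tree theorem) ⇒ `c` is the avatar of an algebraic Hecke character `χ` ⇒ at
a.e. `v`: `{α_j⁻¹} = {e_v α_j}` with `e_v = ι(c(Frob_v))` by `roots_arithFrobPolyOfSatake`, and the
`GL(1)` datum of `χ⁻¹` (suitably normalised; `exists_automorphicRepData_detTwist_glOne`,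
`ContragredientDatum_holds`) has Satake parameter `{e_v}`).  NO de Rham input.  The sibling's K1b in
the crux's L-normalisation. -/
def EssSelfDualOfTwistSelfDualStmt : Prop :=
  ∀ (K : Type) [Field K] [NumberField K], (IsTotallyReal K ∨ IsCMField K) → ∀ (p : ℕ), Nat.Prime p →
    3 ≤ p → ∀ (hcpt : isCompact_glFiniteIntegralLevel p K) (π : CuspidalAutomorphicRepData p K hcpt),
    π.1.IsLAlgebraic → (∃ T : InfinityType K p, π.1.HasInfinityType T ∧ T.IsRegular) →
    ∀ (ℓ : ℕ) [Fact ℓ.Prime] (ι : PadicAlgCl ℓ ≃+* ℂ) (ρ : FramedGaloisRep K (PadicAlgCl ℓ) p),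
      IsCompatibleAE ι π ρ → IsTwistSelfDual ρ → IsEssSelfDualSatake π

/-- **S6 · the semisimple rank of a semisimple compatible avatar does not depend on `(ℓ, ι)`**
(THE HARDEST STUB — Hui's formal bi-character, `HuiCompatibleSemisimpleRank` above, applied to the
family `(ℓ, ι) ↦` the semisimple HLTT representation twisted to the L-normalisation, `E`-rational by
Clozel's Hecke field, unramified off the places over the ramified primes of `π`; the two given
avatars are conjugate to the family members at their indices by Chebotarev–Brauer–Nesbitt, and
`semisimpleRankOf` is conjugation-invariant, `semisimpleRankOf_map_conj`).  Its statement mentions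
neither self-duality nor Hodge theory: a clean target for grounders (Hui 2023 Thm 2.7) and refuters. -/
def SemisimpleRankTransportStmt : Prop :=
  ∀ (K : Type) [Field K] [NumberField K], (IsTotallyReal K ∨ IsCMField K) → ∀ (p : ℕ), Nat.Prime p →
    3 ≤ p → ∀ (hcpt : isCompact_glFiniteIntegralLevel p K) (π : CuspidalAutomorphicRepData p K hcpt),
    π.1.IsLAlgebraic → (∃ T : InfinityType K p, π.1.HasInfinityType T ∧ T.IsRegular) →
    ∀ (ℓ₀ : ℕ) [Fact ℓ₀.Prime] (ι₀ : PadicAlgCl ℓ₀ ≃+* ℂ) (ρ₀ : FramedGaloisRep K (PadicAlgCl ℓ₀) p),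
      IsCompatibleAE ι₀ π ρ₀ → ρ₀.toGaloisRep.IsIrreducible →
    ∀ (ℓ : ℕ) [Fact ℓ.Prime] (ι : PadicAlgCl ℓ ≃+* ℂ) (ρ : FramedGaloisRep K (PadicAlgCl ℓ) p),
      IsCompatibleAE ι π ρ → ρ.toGaloisRep.IsSemisimple → ssRank ρ₀ = ssRank ρ

/-- **S7 · full semisimple rank at `(ℓ, ι)` forces irreducibility of every compatible avatar there**
(continuous semisimplification `ρ ↦ ρ^ss`, compatible with the same Frobenius polynomials; for
semisimple `ρ'` of semisimple rank `p − 1` a `Γ_F`-stable complemented pair `W₁ ⊕ W₂` would put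
`𝔰 = [𝔤, 𝔤]` inside `𝔰𝔩(W₁) ⊕ 𝔰𝔩(W₂)` (`Lie` of a finite-index subgroup is the same,
`semisimpleRankOf_eq_of_finiteIndex`), of rank `≤ p − 2` — the sibling's rank count B1/K1c; so `ρ^ss`
is irreducible, hence so is `ρ`). -/
def IrreducibleOfFullRankStmt : Prop :=
  ∀ (K : Type) [Field K] [NumberField K], (IsTotallyReal K ∨ IsCMField K) → ∀ (p : ℕ), Nat.Prime p →
    3 ≤ p → ∀ (hcpt : isCompact_glFiniteIntegralLevel p K) (π : CuspidalAutomorphicRepData p K hcpt),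
    π.1.IsLAlgebraic → (∃ T : InfinityType K p, π.1.HasInfinityType T ∧ T.IsRegular) →
    ∀ (ℓ : ℕ) [Fact ℓ.Prime] (ι : PadicAlgCl ℓ ≃+* ℂ),
      (∀ ρ' : FramedGaloisRep K (PadicAlgCl ℓ) p, IsCompatibleAE ι π ρ' →
        ρ'.toGaloisRep.IsSemisimple → ssRank ρ' + 1 = p) →
      ∀ ρ : FramedGaloisRep K (PadicAlgCl ℓ) p, IsCompatibleAE ι π ρ → ρ.toGaloisRep.IsIrreducible

/-- Stub S1 (HLTT existence, L-normalised; shared with `Birth.stub_avatarExists`). Size M given the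
vendored fact. -/
theorem stub_avatarExists :
    ∀ (K : Type) [Field K] [NumberField K], (IsTotallyReal K ∨ IsCMField K) → ∀ (p : ℕ), Nat.Prime p →
      3 ≤ p → ∀ (hcpt : isCompact_glFiniteIntegralLevel p K) (π : CuspidalAutomorphicRepData p K hcpt),
      π.1.IsLAlgebraic → (∃ T : InfinityType K p, π.1.HasInfinityType T ∧ T.IsRegular) →
      ∀ (ℓ : ℕ) [Fact ℓ.Prime] (ι : PadicAlgCl ℓ ≃+* ℂ),
        ∃ ρ : FramedGaloisRep K (PadicAlgCl ℓ) p, IsCompatibleAE ι π ρ := by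
  sorry

/-- Stub S2 (Clifford trichotomy in prime dimension). Size M/L. -/
theorem stub_cliffordTrichotomy :
    ∀ (K : Type) [Field K] [NumberField K] (ℓ : ℕ) [Fact ℓ.Prime] (p : ℕ), Nat.Prime p →
      ∀ r : FramedGaloisRep K (PadicAlgCl ℓ) p, r.toGaloisRep.IsIrreducible →
        HasFiniteProjectiveImage r ∨ IsInducedFromDegree p r ∨ IsLieIrreducible r := by
  sorry

/-- Stub S3 (shapes (i)/(ii) propagate; Tate + Clozel + Böckle–Hui + CBN + Mackey). Size L. -/
theorem stub_propagateArtinOrInduced :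
    ∀ (K : Type) [Field K] [NumberField K], (IsTotallyReal K ∨ IsCMField K) → ∀ (p : ℕ), Nat.Prime p →
      3 ≤ p → ∀ (hcpt : isCompact_glFiniteIntegralLevel p K) (π : CuspidalAutomorphicRepData p K hcpt),
      π.1.IsLAlgebraic → (∃ T : InfinityType K p, π.1.HasInfinityType T ∧ T.IsRegular) →
      ∀ (ℓ₀ : ℕ) [Fact ℓ₀.Prime] (ι₀ : PadicAlgCl ℓ₀ ≃+* ℂ) (ρ₀ : FramedGaloisRep K (PadicAlgCl ℓ₀) p),
        IsCompatibleAE ι₀ π ρ₀ → ρ₀.toGaloisRep.IsIrreducible →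
        (HasFiniteProjectiveImage ρ₀ ∨ IsInducedFromDegree p ρ₀) →
      ∀ (ℓ : ℕ) [Fact ℓ.Prime] (ι : PadicAlgCl ℓ ≃+* ℂ) (ρ : FramedGaloisRep K (PadicAlgCl ℓ) p),
        IsCompatibleAE ι π ρ → ρ.toGaloisRep.IsIrreducible := by
  sorry

/-- Stub S4 (Gabber ⇒ semisimple rank `p − 1`; the algebraic-group dictionary). Size L. -/
theorem stub_fullRankOfNotTwistSelfDual :
    ∀ (K : Type) [Field K] [NumberField K] (ℓ : ℕ) [Fact ℓ.Prime] (p : ℕ), Nat.Prime p →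
      ∀ r : FramedGaloisRep K (PadicAlgCl ℓ) p, IsLieIrreducible r → ¬ IsTwistSelfDual r →
        ssRank r + 1 = p := by
  sorry

/-- Stub S5 (twist-self-dual avatar ⇒ essentially self-dual at Satake level). Size M/L. -/
theorem stub_essSelfDualOfTwistSelfDual :
    ∀ (K : Type) [Field K] [NumberField K], (IsTotallyReal K ∨ IsCMField K) → ∀ (p : ℕ), Nat.Prime p →
      3 ≤ p → ∀ (hcpt : isCompact_glFiniteIntegralLevel p K) (π : CuspidalAutomorphicRepData p K hcpt),
      π.1.IsLAlgebraic → (∃ T : InfinityType K p, π.1.HasInfinityType T ∧ T.IsRegular) →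
      ∀ (ℓ : ℕ) [Fact ℓ.Prime] (ι : PadicAlgCl ℓ ≃+* ℂ) (ρ : FramedGaloisRep K (PadicAlgCl ℓ) p),
        IsCompatibleAE ι π ρ → IsTwistSelfDual ρ → IsEssSelfDualSatake π := by
  sorry

/-- Stub S6 (Hui transport of the semisimple rank; THE HARDEST). Size L. -/
theorem stub_semisimpleRankTransport :
    ∀ (K : Type) [Field K] [NumberField K], (IsTotallyReal K ∨ IsCMField K) → ∀ (p : ℕ), Nat.Prime p →
      3 ≤ p → ∀ (hcpt : isCompact_glFiniteIntegralLevel p K) (π : CuspidalAutomorphicRepData p K hcpt),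
      π.1.IsLAlgebraic → (∃ T : InfinityType K p, π.1.HasInfinityType T ∧ T.IsRegular) →
      ∀ (ℓ₀ : ℕ) [Fact ℓ₀.Prime] (ι₀ : PadicAlgCl ℓ₀ ≃+* ℂ) (ρ₀ : FramedGaloisRep K (PadicAlgCl ℓ₀) p),
        IsCompatibleAE ι₀ π ρ₀ → ρ₀.toGaloisRep.IsIrreducible →
      ∀ (ℓ : ℕ) [Fact ℓ.Prime] (ι : PadicAlgCl ℓ ≃+* ℂ) (ρ : FramedGaloisRep K (PadicAlgCl ℓ) p),
        IsCompatibleAE ι π ρ → ρ.toGaloisRep.IsSemisimple → ssRank ρ₀ = ssRank ρ := by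
  sorry

/-- Stub S7 (full rank ⇒ every compatible avatar irreducible; rank count + semisimplification).
Size M/L. -/
theorem stub_irreducibleOfFullRank :
    ∀ (K : Type) [Field K] [NumberField K], (IsTotallyReal K ∨ IsCMField K) → ∀ (p : ℕ), Nat.Prime p →
      3 ≤ p → ∀ (hcpt : isCompact_glFiniteIntegralLevel p K) (π : CuspidalAutomorphicRepData p K hcpt),
      π.1.IsLAlgebraic → (∃ T : InfinityType K p, π.1.HasInfinityType T ∧ T.IsRegular) →
      ∀ (ℓ : ℕ) [Fact ℓ.Prime] (ι : PadicAlgCl ℓ ≃+* ℂ),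
        (∀ ρ' : FramedGaloisRep K (PadicAlgCl ℓ) p, IsCompatibleAE ι π ρ' →
          ρ'.toGaloisRep.IsSemisimple → ssRank ρ' + 1 = p) →
        ∀ ρ : FramedGaloisRep K (PadicAlgCl ℓ) p, IsCompatibleAE ι π ρ → ρ.toGaloisRep.IsIrreducible := by
  sorry

/-! ## §A Assembly (sorry-free) -/

/-- **The seven stub statements imply the crux** `OrdinaryPrimeTransport.PrimeRankTransport` —
concluded here as its BODY (verbatim), not by name, so that `PrimeRankTransport_of` is the unique
declaration concluding the crux by name (registrar shape, as for `Lines/birth.lean`)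
(pure logic + the trichotomy case split): fix the sector data and the good prime `(ℓ₀, ι₀)` of the
crux hypothesis; S1 gives a compatible `ρ₀` there, irreducible by that hypothesis; S2 splits:
shapes (i)/(ii) ⇒ S3 concludes at `(ℓ, ι)` directly; shape (iii) Lie-irreducible ⇒ `ρ₀` is not a
twist of its dual (else S5 makes `π` essentially self-dual at Satake level, excluded by the crux's
clause) ⇒ S4: `ssRank ρ₀ + 1 = p` ⇒ S6: every SEMISIMPLE compatible `ρ'` at `(ℓ, ι)` has
`ssRank ρ' + 1 = p` ⇒ S7: the given `ρ` is irreducible. [folklore] -/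
theorem PrimeRankTransport_of_stubs (h1 : AvatarExistsStmt) (h2 : CliffordTrichotomyStmt)
    (h3 : PropagateArtinOrInducedStmt) (h4 : FullRankOfNotTwistSelfDualStmt)
    (h5 : EssSelfDualOfTwistSelfDualStmt) (h6 : SemisimpleRankTransportStmt)
    (h7 : IrreducibleOfFullRankStmt) :
    -- the BODY of `OrdinaryPrimeTransport.PrimeRankTransport`, verbatim (so that `PrimeRankTransport_of`
    -- below is the unique declaration concluding the crux BY NAME, as the registrar requires)
    ∀ (K : Type) [Field K] [NumberField K], (NumberField.IsTotallyReal K ∨ NumberField.IsCMField K) → ∀ (p : ℕ), Nat.Prime p → 3 ≤ p → ∀ (hcpt : Literature.NumberTheory.Automorphic.isCompact_glFiniteIntegralLevel p K) (π : Literature.NumberTheory.Automorphic.CuspidalAutomorphicRepData p K hcpt), π.1.IsLAlgebraic → (∃ T : Literature.NumberTheory.Automorphic.InfinityType K p, π.1.HasInfinityType T ∧ T.IsRegular) → (∀ (h1 : Literature.NumberTheory.Automorphic.isCompact_glFiniteIntegralLevel 1 K) (η : Literature.NumberTheory.Automorphic.CuspidalAutomorphicRepData 1 K h1), ¬ (∀ᶠ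 v : IsDedekindDomain.HeightOneSpectrum (NumberField.RingOfIntegers K) in Filter.cofinite, ∀ α : Multiset ℂ, π.1.HasSatakeParamAt v α → ∃ e : ℂ, η.1.HasSatakeParamAt v {e} ∧ α.map (fun a => a⁻¹) = α.map (fun a => e * a))) → (∃ (ℓ₀ : ℕ) (_ : Fact ℓ₀.Prime) (ι₀ : PadicAlgCl ℓ₀ ≃+* ℂ), ∀ ρ₀ : Literature.NumberTheory.GaloisRepresentations.FramedGaloisRep K (PadicAlgCl ℓ₀) p, (∀ᶠ v : IsDedekindDomain.HeightOneSpectrum (NumberField.RingOfIntegers K) in Filter.cofinite, Summit.Langlands.SatakeFrobCompatibleAt ι₀ π.1 ρ₀ v) → ρ₀.toGaloisRep.IsIrreducible) → ∀ (ℓ : ℕ) [Fact ℓ.Prime] (ι : PadicAlgCl ℓ ≃+* ℂ) (ρ : Literature.NumberTheory.GaloisRepresentations.FramedGaloisRep K (PadicAlgCl ℓ) p), (∀ᶠ v : IsDedekindDomain.HeightOneSpectrum (NumberField.RingOfIntegers K) in Filter.cofinite, Summit.Langlands.SatakeFrobCompatibleAt ι π.1 ρ v) → ρ.toGaloisRep.IsIrreducible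 := by
  intro K _ _ hK p hp h3p hcpt π hL hreg hnsd hgood ℓ _ ι ρ hρ
  obtain ⟨ℓ₀, hF₀, ι₀, hall⟩ := hgood
  haveI : Fact ℓ₀.Prime := hF₀
  -- the compatible partner at the good prime, irreducible by the crux hypothesis
  obtain ⟨ρ₀, hρ₀⟩ := h1 K hK p hp h3p hcpt π hL hreg ℓ₀ ι₀
  have hirr₀ : ρ₀.toGaloisRep.IsIrreducible := hall ρ₀ hρ₀
  -- Clifford trichotomy on `ρ₀`
  rcases h2 K ℓ₀ p hp ρ₀ hirr₀ with hfin | hind | hLie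
  · exact h3 K hK p hp h3p hcpt π hL hreg ℓ₀ ι₀ ρ₀ hρ₀ hirr₀ (Or.inl hfin) ℓ ι ρ hρ
  · exact h3 K hK p hp h3p hcpt π hL hreg ℓ₀ ι₀ ρ₀ hρ₀ hirr₀ (Or.inr hind) ℓ ι ρ hρ
  · -- Lie-irreducible: not a twist of the dual, else essentially self-dual at Satake level
    have hnsd₀ : ¬ IsTwistSelfDual ρ₀ := by
      intro hsd
      obtain ⟨h1', η, hη⟩ := h5 K hK p hp h3p hcpt π hL hreg ℓ₀ ι₀ ρ₀ hρ₀ hsd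
      exact hnsd h1' η hη
    -- Gabber: full semisimple rank at the good prime
    have hrank₀ : ssRank ρ₀ + 1 = p := h4 K ℓ₀ p hp ρ₀ hLie hnsd₀
    -- Hui: full rank of every semisimple compatible avatar at `(ℓ, ι)`; then the rank count
    refine h7 K hK p hp h3p hcpt π hL hreg ℓ ι ?_ ρ hρ
    intro ρ' hρ' hss'
    rw [← h6 K hK p hp h3p hcpt π hL hreg ℓ₀ ι₀ ρ₀ hρ₀ hirr₀ ℓ ι ρ' hρ' hss']
    exact hrank₀

/-- **THE SKELETON THEOREM (registrar shape).** The crux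
`Summit.Langlands.Langlands.Theses.OrdinaryPrimeTransport.PrimeRankTransport` concluded BY NAME,
without hypotheses, from the seven declared stubs through the sorry-free
`PrimeRankTransport_of_stubs`. -/
theorem PrimeRankTransport_of : PrimeRankTransport :=
  PrimeRankTransport_of_stubs stub_avatarExists stub_cliffordTrichotomy
    stub_propagateArtinOrInduced stub_fullRankOfNotTwistSelfDual stub_essSelfDualOfTwistSelfDual
    stub_semisimpleRankTransport stub_irreducibleOfFullRank

end Summit.Langlands.Langlands.Cruxes.PrimeRankTransport.CliffordGabberHui

end
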